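import Literature.Computability.Cryptography.QuantumTuringMachineProofs
import Literature.Computability.Cryptography.QubitRegister
import Literature.Computability.Complexity.BrickAlgebra
import Literature.Computability.Complexity.FoldBricks
import Literature.Computability.Complexity.StackBricksArith
import Literature.Computability.Complexity.TimeBoundsProofs
import HarnessLib

/-!
# The entries of the Clifford+T gates are polynomial-time computable complex numbers

Topic `Literature/Computability/Cryptography` (trunk CryptoQuantFine, Q1 `QubitRegister` and Q8
`QuantumTuringMachine`). The robustness theorems for `BQP` — gate-set independence
`Literature.Computability.QuantumComplexity.BQPOver_eq_BQP` (`QuantumComplexity/BQP.lean`,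
quantum-advantage.S26) and its promise form `PromiseBQPOver_eq_PromiseBQP`, and the equivalence
with quantum Turing machines `BQPQTM_eq_BQP` — compare circuit families over a finite gate set `G`
with Clifford+T families under the hypothesis that the gates of `G` have *polynomial-time
computable entries* (Bernstein–Vazirani 1997, Def. 3.2: the class `C̃` of complex numbers whose real
and imaginary parts can be approximated to within `2⁻ⁿ` by a deterministic algorithm in time
polynomial in `n`; the tree's `IsPolyTimeComputableComplex`, Ko 1991, Def. 2.1), and the uniform
compilers in their proofs need the SAME property of the reference set Clifford+T itself: the
compiling Turing machine must produce `n`-bit approximations of `1/√2` and `e^{iπ/4}`. This file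
PROVES it:

* `cliffordT_polyTimeEntries : ∀ g i j, cliffordT.mat g i j ∈ polyTimeComputableComplex` — the
  entries `0, 1, ±1/√2, i, e^{iπ/4} = (1 + i)/√2` of `H, S, T, CNOT`; also
  `toffoliH_polyTimeEntries` for the Toffoli+Hadamard set `{H, X, CNOT, TOF}`.

This is one of the hypotheses of the proved reduction `BQPOver_eq_BQP_of` of
`QuantumComplexity/BQPGateSetIndependence.lean` and the Clifford+T half (`.inl`) of the named fact
`ajlGateSet_polyTimeEntries` (`QuantumComplexity/JonesInBQPProofs.lean`).

## The proof

Rationals are polynomial-time computable reals (`IsPolyTimeComputableReal.ratCast_holds`,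
`QuantumTuringMachineProofs.lean`), which covers `0, 1, i`. For `1/√2 = √2/2 = cos(π/4) = sin(π/4)`
we exhibit the dyadic name `n ↦ ⌊2ⁿ/√2⌋ = ⌊√(4ⁿ/2)⌋` (`abs_one_div_sqrt_two_sub_le`:
`0 ≤ 1/√2 − ⌊2ⁿ/√2⌋/2ⁿ < 2⁻ⁿ`) and compute it in polynomial time from the unary input `1ⁿ` by the
schoolbook **digit-by-digit integer square root** (one base-`4` digit of the radicand per round:
from `s = ⌊√(q/4)⌋` to `⌊√q⌋ ∈ {2s, 2s + 1}`, `SqrtHalf.nat_sqrt_eq_of_div_four`; Knuth, TAOCP 2,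
§4.3.1 style), written in the tree's `FP` brick algebra (`BrickAlgebra.lean`: a counted loop
`loopFn_mem_FP` of `n` rounds on the record `⟨⟨1ⁿ, bin (4ⁿ/2)⟩, ⟨counter, ⟨bin t, bin P⟩⟩⟩`,
`P = 4^{n-1}, …, 4, 1` the digit scale, with the arithmetic leaves `addFn`, `prodFn`, `divFn`, `ltFn`
of `StackBricks*.lean` and `powFn 1 : 1ⁿ ↦ bin 2ⁿ` of `NSubexp.lean`) — no Turing machine is written
by hand; `PolyTimeComputable.of_encode` re-indexes the string function along `unaryEncodeNat`.
Negation of a polynomial-time computable real is one (`IsPolyTimeComputableReal.neg`, by the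
`FP` brick `signMagOfZF ∘ znegF ∘ ofSMFn` on the sign–magnitude codes of `encodingIntBool` and
`PolyTimeComputable.comp_holds`), which covers `-1/√2`; and `e^{iπ/4}` has real and imaginary part
`cos(π/4) = sin(π/4) = √2/2` (`Real.cos_pi_div_four`, `Real.sin_pi_div_four`).

No definition of a notion and no named fact is introduced: the `def`s below are the concrete
string functions of the machine (brick-algebra terms), each with its `∈ FP` lemma and its value.

## References

* E. Bernstein, U. Vazirani, *Quantum complexity theory*, SIAM J. Comput. 26 (1997) 1411–1473,
  Def. 3.2 (polynomial-time computable amplitudes) and §6 [BernsteinVazirani1997].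
* K.-I. Ko, *Complexity Theory of Real Functions*, Birkhäuser 1991, Def. 2.1, §2.1–2.2
  (polynomial-time computable reals form a field containing the algebraic reals) [Ko1991].
* D. E. Knuth, *The Art of Computer Programming*, Vol. 2, 3rd ed. 1998, §4.3.1 (multiple-precision
  arithmetic). (Schoolbook; the digit-by-digit square root is fully proved here.)
* S. Arora, B. Barak, *Computational Complexity: A Modern Approach*, CUP 2009, §1.3 (polynomial
  time is closed under composition and bounded loops) [AroraBarak2009].
* M. A. Nielsen, I. L. Chuang, *Quantum Computation and Quantum Information*, CUP 2010, §4.2,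
  Fig. 4.2 (the gates `H, S, T`), §1.3.2 (`CNOT`) [NielsenChuang2010].
-/

noncomputable section

namespace Literature.Computability.Cryptography

open _root_.Computability Polynomial Literature.Computability.Complexity
  Literature.Computability.Complexity.Brick Literature.Computability.Complexity.TimeConstructible

/-! ### Negation of polynomial-time computable reals -/

/-- Negation on the sign–magnitude integer codes of `encodingIntBool`: decode to a difference
pair (`ofSMFn`), negate canonically (`znegF`), re-encode (`signMagOfZF`). [folklore] -/
def negSMF : List Bool → List Bool := signMagOfZF ∘ znegF ∘ ofSMFn

/-- `negSMF ∈ FP`. [cite: AroraBarak2009, §1.3] -/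
theorem negSMF_mem_FP : negSMF ∈ FP :=
  comp_mem_FP signMagOfZF_mem_FP (comp_mem_FP znegF_mem_FP ofSMFn_mem_FP)

/-- `negSMF` maps the code of `z` to the code of `-z`. [folklore] -/
theorem negSMF_encode (z : ℤ) : negSMF (encodingIntBool.encode z) = encodingIntBool.encode (-z) := by
  have h : ∀ w : ℤ, encodingIntBool.encode w = boolPair [decide (w < 0)] (encodeNat w.natAbs) :=
    fun _ => rfl
  simp only [negSMF, Function.comp_apply, h, ofSMFn_encode, znegF_eq, ival_dpEnc, signMagOfZF_dpEnc]

/-- Integer negation is polynomial-time on `encodingIntBool` codes. [cite: AroraBarak2009, §1.3] -/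
theorem polyTimeComputable_int_neg :
    PolyTimeComputable encodingIntBool.encode encodingIntBool.encode (fun z : ℤ => -z) :=
  negSMF_mem_FP.of_encode (g := encodingIntBool.encode) (fun _ => rfl) fun z => negSMF_encode z

/-- **Polynomial-time computable reals are closed under negation**: negate the dyadic name
(`|(-x) - (-f n)/2ⁿ| = |x - f n/2ⁿ|`), composing its machine with integer negation
(`PolyTimeComputable.comp_holds`). [cite: Ko1991, §2.2 (the polynomial-time computable reals form a field)] -/
theorem IsPolyTimeComputableReal.neg {x : ℝ} (h : IsPolyTimeComputableReal x) :
    IsPolyTimeComputableReal (-x) := by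
  obtain ⟨f, hf, happ⟩ := h
  refine ⟨fun n => -f n, PolyTimeComputable.comp_holds polyTimeComputable_int_neg hf, fun n => ?_⟩
  rw [Int.cast_neg, neg_div, ← abs_neg]
  convert happ n using 2
  ring

/-- Polynomial-time computable complex numbers are closed under negation.
[cite: BernsteinVazirani1997, Def. 3.2] -/
theorem IsPolyTimeComputableComplex.neg {z : ℂ} (h : IsPolyTimeComputableComplex z) :
    IsPolyTimeComputableComplex (-z) :=
  ⟨by rw [Complex.neg_re]; exact h.1.neg, by rw [Complex.neg_im]; exact h.2.neg⟩

/-! ### The dyadic name `n ↦ ⌊2ⁿ/√2⌋ = ⌊√(4ⁿ/2)⌋` is polynomial-time computable -/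

namespace SqrtHalf

/-! #### The digit-by-digit integer square root -/

/-- **One base-`4` digit of the square root.** With `s = ⌊√(q/4)⌋`, `⌊√q⌋` is `2s` or `2s + 1`,
according to whether `q < (2s+1)²`: indeed `(2s)² ≤ 4 (q/4) ≤ q < 4 (q/4 + 1) ≤ 4 (s+1)² = (2s+2)²`.
[folklore] -/
theorem nat_sqrt_eq_of_div_four (q : ℕ) :
    Nat.sqrt q = if q < (2 * Nat.sqrt (q / 4) + 1) ^ 2 then 2 * Nat.sqrt (q / 4)
      else 2 * Nat.sqrt (q / 4) + 1 := by
  set s := Nat.sqrt (q / 4) with hs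
  have h1 : s ^ 2 ≤ q / 4 := Nat.sqrt_le' _
  have h2 : q / 4 < (s + 1) ^ 2 := Nat.lt_succ_sqrt' _
  have h3 : q / 4 * 4 ≤ q := by omega
  have h4 : q < (q / 4 + 1) * 4 := by omega
  split_ifs with h
  · symm
    rw [Nat.eq_sqrt']
    exact ⟨by nlinarith, h⟩
  · symm
    rw [Nat.eq_sqrt']
    exact ⟨not_lt.1 h, by nlinarith⟩

/-- The model of one round of the loop on the state `(t, P)` (`t` the root computed so far, `P` the
current digit scale): `t ↦ 2t + [(2t+1)² ≤ M / P]`, `P ↦ P / 4`. [folklore] -/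
def digitStep (M : ℕ) (tP : ℕ × ℕ) : ℕ × ℕ :=
  (if M / tP.2 < (2 * tP.1 + 1) ^ 2 then 2 * tP.1 else 2 * tP.1 + 1, tP.2 / 4)

/-- **Correctness of the digit-by-digit square root**: `k` rounds from `(⌊√(M/4ᵏ)⌋, 4ᵏ/4)` end at
`(⌊√M⌋, 0)` (induction on `k`, one digit per round by `nat_sqrt_eq_of_div_four`). [folklore] -/
theorem iterate_digitStep (M : ℕ) : ∀ k : ℕ,
    (digitStep M)^[k] (Nat.sqrt (M / 4 ^ k), 4 ^ k / 4) = (Nat.sqrt M, 0)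
  | 0 => by simp
  | k + 1 => by
    rw [Function.iterate_succ_apply]
    have hq : M / 4 ^ (k + 1) = M / 4 ^ k / 4 := by rw [pow_succ, Nat.div_div_eq_div_mul]
    have hP : 4 ^ (k + 1) / 4 = 4 ^ k := by rw [pow_succ, Nat.mul_div_cancel _ (by norm_num)]
    have hstep : digitStep M (Nat.sqrt (M / 4 ^ (k + 1)), 4 ^ (k + 1) / 4) =
        (Nat.sqrt (M / 4 ^ k), 4 ^ k / 4) := by
      simp only [digitStep, hP, hq]
      rw [← nat_sqrt_eq_of_div_four]
    rw [hstep, iterate_digitStep M k]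

/-- For `M < 4ⁿ`, `n` rounds from `(0, 4ⁿ/4)` compute `⌊√M⌋`. [folklore] -/
theorem iterate_digitStep_of_lt {M n : ℕ} (h : M < 4 ^ n) :
    (digitStep M)^[n] (0, 4 ^ n / 4) = (Nat.sqrt M, 0) := by
  have := iterate_digitStep M n
  rwa [Nat.div_eq_of_lt h, Nat.sqrt_zero] at this

/-! #### Coded records -/

/-- The coded state `⟨bin t, bin P⟩`. [folklore] -/
def srec (tP : ℕ × ℕ) : List Bool := boolPair (encodeNat tP.1) (encodeNat tP.2)

/-- The coded context `⟨u, bin M⟩` (`u` the unary input, a ruler for the number of rounds; `M` the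
radicand). [folklore] -/
def xrec (u : List Bool) (M : ℕ) : List Bool := boolPair u (encodeNat M)

/-- The loop record `⟨x, ⟨counter, state⟩⟩` of `BrickAlgebra.loopStep`. [folklore] -/
def lrec (x cnt st : List Bool) : List Bool := boolPair x (boolPair cnt st)

/-- Pairing of two field functions. [folklore] -/
abbrev pr (f g : List Bool → List Bool) : List Bool → List Bool := fanoutFn f g

/-- The radicand `M` (second component of field `0`). [folklore] -/
abbrev radP : List Bool → List Bool := sndF ∘ nthF 0
/-- The root so far `t` (field `2`). [folklore] -/
abbrev tP : List Bool → List Bool := nthF 2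
/-- The scale `P` (the tail after field `2`). [folklore] -/
abbrev scP : List Bool → List Bool := sndPow 2

section Base

variable (u x cnt st : List Bool) (M : ℕ) (tP' : ℕ × ℕ)

/-- Field `0` of the loop record. [folklore] -/
@[simp] theorem nthF_zero_lrec : nthF 0 (lrec x cnt st) = x := by simp [lrec]
/-- First component of the loop record. [folklore] -/
@[simp] theorem fstF_lrec : fstF (lrec x cnt st) = x := by simp [lrec]
/-- The state of the loop record. [folklore] -/
@[simp] theorem sndPow_one_lrec : sndPow 1 (lrec x cnt st) = st := by simp [lrec]
/-- `t`. [folklore] -/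
@[simp] theorem nthF_two_lrec : nthF 2 (lrec x cnt (srec tP')) = encodeNat tP'.1 := by
  simp [lrec, srec]
/-- `P`. [folklore] -/
@[simp] theorem sndPow_two_lrec : sndPow 2 (lrec x cnt (srec tP')) = encodeNat tP'.2 := by
  simp [lrec, srec]
/-- The ruler `u`. [folklore] -/
@[simp] theorem fstF_xrec : fstF (xrec u M) = u := by simp [xrec]
/-- The radicand `M`. [folklore] -/
@[simp] theorem sndF_xrec : sndF (xrec u M) = encodeNat M := by simp [xrec]
/-- Length of the context. [folklore] -/
theorem length_xrec : (xrec u M).length = 2 * u.length + 2 + (encodeNat M).length := by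
  simp [xrec, length_boolPair]

end Base

/-! #### The body of the loop -/

/-- `bin (M / P)`. [folklore] -/
def quoF : List Bool → List Bool := divFn ∘ pr radP scP
/-- `bin (2t)`. [folklore] -/
def dblF : List Bool → List Bool := addFn ∘ pr tP tP
/-- `bin (2t + 1)`. [folklore] -/
def oddF : List Bool → List Bool := addFn ∘ pr dblF (fun _ => [true])
/-- `bin ((2t+1)²)`. [folklore] -/
def sqF : List Bool → List Bool := prodFn ∘ pr oddF oddF
/-- The digit test `[M / P < (2t+1)²]`. [folklore] -/
def testF : List Bool → List Bool := ltFn ∘ pr quoF sqF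
/-- The new root `2t` or `2t + 1`. [folklore] -/
def newTF : List Bool → List Bool := iteFn testF dblF oddF
/-- The new scale `P / 4`. [folklore] -/
def newPF : List Bool → List Bool := divFn ∘ pr scP (fun _ => encodeNat 4)
/-- **The body of the loop**: the new state `⟨bin t', bin (P/4)⟩`. [folklore] -/
def sqrtRoundF : List Bool → List Bool := pr newTF newPF

/-- `quoF ∈ FP`. [folklore] -/
theorem quoF_mem_FP : quoF ∈ FP :=
  comp_mem_FP divFn_mem_FP (fanoutFn_mem_FP (comp_mem_FP sndF_mem_FP (nthF_mem_FP 0)) (sndPow_mem_FP 2))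
/-- `dblF ∈ FP`. [folklore] -/
theorem dblF_mem_FP : dblF ∈ FP :=
  comp_mem_FP addFn_mem_FP (fanoutFn_mem_FP (nthF_mem_FP 2) (nthF_mem_FP 2))
/-- `oddF ∈ FP`. [folklore] -/
theorem oddF_mem_FP : oddF ∈ FP :=
  comp_mem_FP addFn_mem_FP (fanoutFn_mem_FP dblF_mem_FP (const_mem_FP _))
/-- `sqF ∈ FP`. [folklore] -/
theorem sqF_mem_FP : sqF ∈ FP :=
  comp_mem_FP prodFn_mem_FP (fanoutFn_mem_FP oddF_mem_FP oddF_mem_FP)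
/-- `testF ∈ FP`. [folklore] -/
theorem testF_mem_FP : testF ∈ FP :=
  comp_mem_FP ltFn_mem_FP (fanoutFn_mem_FP quoF_mem_FP sqF_mem_FP)
/-- `newTF ∈ FP`. [folklore] -/
theorem newTF_mem_FP : newTF ∈ FP := iteFn_mem_FP testF_mem_FP dblF_mem_FP oddF_mem_FP
/-- `newPF ∈ FP`. [folklore] -/
theorem newPF_mem_FP : newPF ∈ FP :=
  comp_mem_FP divFn_mem_FP (fanoutFn_mem_FP (sndPow_mem_FP 2) (const_mem_FP _))
/-- **`sqrtRoundF ∈ FP`.** [cite: AroraBarak2009, §1.3] -/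
theorem sqrtRoundF_mem_FP : sqrtRoundF ∈ FP := fanoutFn_mem_FP newTF_mem_FP newPF_mem_FP

/-- `testF` is one-bit. [folklore] -/
theorem oneBit_testF : OneBit testF := oneBit_ltFn.comp _

/-- A numeral `bin (2v + 1)` is one symbol longer than `bin v` at most; so is `bin (2v)`.
[folklore] -/
theorem length_encodeNat_double_le (v : ℕ) (b : ℕ) (hb : b ≤ 1) :
    (encodeNat (2 * v + b)).length ≤ (encodeNat v).length + 1 := by
  rw [TM2Pass.length_encodeNat_eq_size, TM2Pass.length_encodeNat_eq_size, Nat.size_le]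
  have := Nat.lt_size_self v
  rw [pow_succ]
  omega

/-- The new root is at most one symbol longer than the old one. [folklore] -/
theorem length_newTF_le (z : List Bool) : (newTF z).length ≤ (nthF 2 z).length + 1 := by
  have hd : dblF z = encodeNat (2 * bitsToNat (nthF 2 z) + 0) := by simp [dblF, two_mul]
  have ho : oddF z = encodeNat (2 * bitsToNat (nthF 2 z) + 1) := by simp [oddF, dblF, two_mul]
  have hv : (encodeNat (bitsToNat (nthF 2 z))).length ≤ (nthF 2 z).length :=
    length_encodeNat_bitsToNat_le _
  rw [newTF, iteFn_of_oneBit oneBit_testF]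
  split_ifs
  · rw [hd]; exact (length_encodeNat_double_le _ 0 (by norm_num)).trans (by omega)
  · rw [ho]; exact (length_encodeNat_double_le _ 1 le_rfl).trans (by omega)

/-- The new scale is no longer than the old one. [folklore] -/
theorem length_newPF_le (z : List Bool) : (newPF z).length ≤ (sndPow 2 z).length := by
  have h : newPF z = encodeNat (bitsToNat (sndPow 2 z) / 4) := by simp [newPF]
  rw [h]
  exact (length_encodeNat_mono (Nat.div_le_self _ _)).trans (length_encodeNat_bitsToNat_le _)

/-- **Growth of the body**: `|sqrtRoundF z| ≤ |state| + 4` on every record (well-formed or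
not). [folklore] -/
theorem length_sqrtRoundF_le (z : List Bool) :
    (sqrtRoundF z).length ≤ (sndPow 1 z).length + 4 * ((fstF z).length + 1) := by
  have h1 := length_newTF_le z
  have h2 := length_newPF_le z
  have h3 : 2 * (nthF 2 z).length + (sndPow 2 z).length ≤ (sndPow 1 z).length :=
    length_nthF_succ_add_sndPow_succ_le 1 z
  have e : (sqrtRoundF z).length = 2 * (newTF z).length + 2 + (newPF z).length := by
    simp [sqrtRoundF, length_boolPair]
  rw [e]
  nlinarith

/-- **One round on a coded state is the coded next state of the model.** [folklore] -/
theorem sqrtRoundF_lrec (u cnt : List Bool) (M : ℕ) (tP' : ℕ × ℕ) :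
    sqrtRoundF (lrec (xrec u M) cnt (srec tP')) = srec (digitStep M tP') := by
  obtain ⟨t, P⟩ := tP'
  have hq : quoF (lrec (xrec u M) cnt (srec (t, P))) = encodeNat (M / P) := by simp [quoF]
  have hd : dblF (lrec (xrec u M) cnt (srec (t, P))) = encodeNat (2 * t) := by simp [dblF, two_mul]
  have ho : oddF (lrec (xrec u M) cnt (srec (t, P))) = encodeNat (2 * t + 1) := by
    simp [oddF, dblF, two_mul]
  have hs : sqF (lrec (xrec u M) cnt (srec (t, P))) = encodeNat ((2 * t + 1) ^ 2) := by
    simp [sqF, ho, sq]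
  have ht : testF (lrec (xrec u M) cnt (srec (t, P))) = [decide (M / P < (2 * t + 1) ^ 2)] := by
    simp [testF, hq, hs]
  have hT : newTF (lrec (xrec u M) cnt (srec (t, P))) =
      encodeNat (if M / P < (2 * t + 1) ^ 2 then 2 * t else 2 * t + 1) := by
    rw [newTF, iteFn_apply ht]
    by_cases h : M / P < (2 * t + 1) ^ 2
    · rw [decide_eq_true h, if_pos rfl, if_pos h, hd]
    · rw [decide_eq_false h, if_neg h, ho]; rfl
  have hPn : newPF (lrec (xrec u M) cnt (srec (t, P))) = encodeNat (P / 4) := by simp [newPF]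
  rw [show sqrtRoundF (lrec (xrec u M) cnt (srec (t, P))) =
      boolPair (newTF (lrec (xrec u M) cnt (srec (t, P)))) (newPF (lrec (xrec u M) cnt (srec (t, P))))
    from fanoutFn_apply _ _ _, hT, hPn]
  rfl

/-- **The loop runs the model.** [folklore] -/
theorem loopModel_sqrtRoundF (u : List Bool) (M : ℕ) : ∀ (k : ℕ) (tP' : ℕ × ℕ),
    loopModel sqrtRoundF (xrec u M) k (srec tP') = srec ((digitStep M)^[k] tP')
  | 0, _ => rfl
  | k + 1, tP' => by
    rw [loopModel, ← lrec, sqrtRoundF_lrec, loopModel_sqrtRoundF u M k, Function.iterate_succ_apply]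

/-! #### The whole machine -/

/-- `bin (4ⁿ)` from `1ⁿ`: `bin 2ⁿ · bin 2ⁿ` (`powFn 1`). [folklore] -/
def pow4F : List Bool → List Bool := prodFn ∘ pr (powFn 1) (powFn 1)
/-- The radicand `bin (4ⁿ / 2)`. [folklore] -/
def radF : List Bool → List Bool := divFn ∘ pr pow4F (fun _ => encodeNat 2)
/-- The initial scale `bin (4ⁿ / 4)`. [folklore] -/
def sc0F : List Bool → List Bool := divFn ∘ pr pow4F (fun _ => encodeNat 4)
/-- The initial loop record `⟨⟨1ⁿ, bin (4ⁿ/2)⟩, ⟨bin n, ⟨bin 0, bin (4ⁿ/4)⟩⟩⟩`. [folklore] -/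
def sqrtInitF : List Bool → List Bool := pr (pr id radF) (pr lenBinF (pr (fun _ => []) sc0F))
/-- `|x|` rounds of the loop (`x` = field `0`), at least `n` of them. [folklore] -/
def sqrtLoopF : List Bool → List Bool := fun z => (loopStep sqrtRoundF)^[(X : ℕ[X]).eval (fstF z).length] z
/-- **The name machine**: `1ⁿ ↦ ⟨[false], bin ⌊√(4ⁿ/2)⌋⟩`, the `encodingIntBool` code of the
nonnegative integer `⌊2ⁿ/√2⌋`. [folklore] -/
def sqrtHalfNameF : List Bool → List Bool := pr (fun _ => [false]) (tP ∘ sqrtLoopF ∘ sqrtInitF)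

/-- `pow4F ∈ FP`. [folklore] -/
theorem pow4F_mem_FP : pow4F ∈ FP :=
  comp_mem_FP prodFn_mem_FP (fanoutFn_mem_FP (powFn_mem_FP 1) (powFn_mem_FP 1))
/-- `radF ∈ FP`. [folklore] -/
theorem radF_mem_FP : radF ∈ FP :=
  comp_mem_FP divFn_mem_FP (fanoutFn_mem_FP pow4F_mem_FP (const_mem_FP _))
/-- `sc0F ∈ FP`. [folklore] -/
theorem sc0F_mem_FP : sc0F ∈ FP :=
  comp_mem_FP divFn_mem_FP (fanoutFn_mem_FP pow4F_mem_FP (const_mem_FP _))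
/-- `sqrtInitF ∈ FP`. [folklore] -/
theorem sqrtInitF_mem_FP : sqrtInitF ∈ FP :=
  fanoutFn_mem_FP (fanoutFn_mem_FP OracleCompose.id_mem_FP radF_mem_FP)
    (fanoutFn_mem_FP lenBinF_mem_FP (fanoutFn_mem_FP (const_mem_FP _) sc0F_mem_FP))
/-- **`sqrtLoopF ∈ FP`** (`loopFn_mem_FP` with the growth bound `length_sqrtRoundF_le`).
[cite: AroraBarak2009, §1.3 (bounded loops)] -/
theorem sqrtLoopF_mem_FP : sqrtLoopF ∈ FP := loopFn_mem_FP sqrtRoundF_mem_FP length_sqrtRoundF_le X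
/-- **`sqrtHalfNameF ∈ FP`.** [cite: AroraBarak2009, §1.3] -/
theorem sqrtHalfNameF_mem_FP : sqrtHalfNameF ∈ FP :=
  fanoutFn_mem_FP (const_mem_FP _) (comp_mem_FP (nthF_mem_FP 2) (comp_mem_FP sqrtLoopF_mem_FP sqrtInitF_mem_FP))

/-- `pow4F (1ⁿ) = bin (4ⁿ)`. [folklore] -/
theorem pow4F_unary (n : ℕ) : pow4F (unaryEncodeNat n) = encodeNat (4 ^ n) := by
  have h4 : 2 ^ n * 2 ^ n = 4 ^ n := by rw [← mul_pow]; norm_num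
  simp [pow4F, powFn_unary, h4]

/-- The initial record on `1ⁿ`. [folklore] -/
theorem sqrtInitF_unary (n : ℕ) : sqrtInitF (unaryEncodeNat n) =
    lrec (xrec (unaryEncodeNat n) (4 ^ n / 2)) (encodeNat n) (srec (0, 4 ^ n / 4)) := by
  have hl : (unaryEncodeNat n).length = n := by
    rw [OracleCompose.unaryEncodeNat_eq_replicate, List.length_replicate]
  simp [sqrtInitF, radF, sc0F, pow4F_unary, hl, lrec, xrec, srec, show encodeNat 0 = [] from rfl]

/-- **The loop on the initial record** ends with the state `⟨bin ⌊√(4ⁿ/2)⌋, bin 0⟩`: `n ≤ |x|`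
rounds are available (`iterate_loopStep`), the loop runs the model (`loopModel_sqrtRoundF`), and the
model is the digit-by-digit square root (`iterate_digitStep_of_lt`, as `4ⁿ/2 < 4ⁿ`). [folklore] -/
theorem loopF_initF_unary (n : ℕ) : sqrtLoopF (sqrtInitF (unaryEncodeNat n)) =
    lrec (xrec (unaryEncodeNat n) (4 ^ n / 2)) [] (srec (Nat.sqrt (4 ^ n / 2), 0)) := by
  have hlt : 4 ^ n / 2 < 4 ^ n := Nat.div_lt_self (pow_pos (by norm_num) n) one_lt_two
  have hn : n ≤ (X : ℕ[X]).eval (xrec (unaryEncodeNat n) (4 ^ n / 2)).length := by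
    rw [eval_X, length_xrec, OracleCompose.unaryEncodeNat_eq_replicate, List.length_replicate]
    omega
  rw [sqrtInitF_unary, sqrtLoopF, fstF_lrec, lrec, iterate_loopStep sqrtRoundF _ n _ _ hn, loopModel_sqrtRoundF,
    iterate_digitStep_of_lt hlt, lrec]

/-- **Value of the name machine**: `sqrtHalfNameF (1ⁿ) = encodingIntBool.encode ⌊√(4ⁿ/2)⌋`. [folklore] -/
theorem sqrtHalfNameF_unary (n : ℕ) :
    sqrtHalfNameF (unaryEncodeNat n) = encodingIntBool.encode ((Nat.sqrt (4 ^ n / 2) : ℕ) : ℤ) := by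
  have h : ∀ w : ℤ, encodingIntBool.encode w = boolPair [decide (w < 0)] (encodeNat w.natAbs) :=
    fun _ => rfl
  rw [h, Int.natAbs_natCast]
  simp only [sqrtHalfNameF, fanoutFn_apply, Function.comp_apply, loopF_initF_unary, nthF_two_lrec]
  congr 2

end SqrtHalf

/-- **The dyadic name `n ↦ ⌊2ⁿ/√2⌋ = ⌊√(4ⁿ/2)⌋` of `1/√2` is polynomial-time computable** from the
unary input `1ⁿ` to the integer code `encodingIntBool` (the `FP` string function
`SqrtHalf.sqrtHalfNameF`, re-indexed along `unaryEncodeNat`). [cite: Ko1991, §2.1–2.2] -/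
theorem polyTimeComputable_sqrtHalfName :
    PolyTimeComputable unaryEncodeNat encodingIntBool.encode
      (fun n : ℕ => ((Nat.sqrt (4 ^ n / 2) : ℕ) : ℤ)) :=
  SqrtHalf.sqrtHalfNameF_mem_FP.of_encode (g := unaryEncodeNat) (fun _ => rfl)
    fun n => SqrtHalf.sqrtHalfNameF_unary n

/-- **The approximation bound**: `|1/√2 − ⌊√(4ⁿ/2)⌋/2ⁿ| ≤ 2⁻ⁿ`; in fact with `k = ⌊√(4ⁿ/2)⌋`,
`k √2 ≤ 2ⁿ < (k+1) √2` (square both sides: `2k² ≤ 2⌊4ⁿ/2⌋ ≤ 4ⁿ ≤ 2⌊4ⁿ/2⌋ + 1 < 2(k+1)²`), so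
`0 ≤ 1/√2 − k/2ⁿ = (2ⁿ − k√2)/(√2 · 2ⁿ) < 1/2ⁿ`. [folklore] -/
theorem abs_one_div_sqrt_two_sub_le (n : ℕ) :
    |1 / Real.sqrt 2 - (((Nat.sqrt (4 ^ n / 2) : ℕ) : ℤ) : ℝ) / 2 ^ n| ≤ (1 / 2 : ℝ) ^ n := by
  set K := 4 ^ n / 2 with hK
  set k := Nat.sqrt K with hk
  have h1 : k * k ≤ K := Nat.sqrt_le K
  have h2 : K < (k + 1) * (k + 1) := Nat.lt_succ_sqrt K
  have h3 : 2 * K ≤ 4 ^ n := Nat.mul_div_le (4 ^ n) 2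
  have h4 : 4 ^ n ≤ 2 * K + 1 := by omega
  set s := Real.sqrt 2 with hs
  have hs0 : 0 < s := Real.sqrt_pos.2 (by norm_num)
  have hss : s * s = 2 := Real.mul_self_sqrt (by norm_num)
  set y : ℝ := 2 ^ n with hy
  have hy0 : 0 < y := by positivity
  have hyy : y * y = ((4 ^ n : ℕ) : ℝ) := by
    rw [hy, ← mul_pow]; push_cast; norm_num
  have h1R : (k : ℝ) * k ≤ K := by exact_mod_cast h1
  have h2R : (K : ℝ) < (k + 1) * (k + 1) := by exact_mod_cast h2
  have h3R : 2 * (K : ℝ) ≤ ((4 ^ n : ℕ) : ℝ) := by exact_mod_cast h3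
  have h4R : ((4 ^ n : ℕ) : ℝ) ≤ 2 * K + 1 := by exact_mod_cast h4
  have hk0 : (0 : ℝ) ≤ k := Nat.cast_nonneg k
  -- `k s ≤ y < (k + 1) s`
  have h2R' : (K : ℝ) + 1 ≤ (k + 1) * (k + 1) := by exact_mod_cast Nat.succ_le_of_lt h2
  have hlo : (k : ℝ) * s ≤ y := by
    by_contra hcon
    push Not at hcon
    have hm := mul_lt_mul'' hcon hcon hy0.le hy0.le
    have e : (k : ℝ) * s * ((k : ℝ) * s) = (k : ℝ) * k * (s * s) := by ring
    rw [e, hss, hyy] at hm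
    linarith
  have hhi : y < ((k : ℝ) + 1) * s := by
    by_contra hcon
    push Not at hcon
    have hm := mul_le_mul hcon hcon (by positivity) hy0.le
    have e : ((k : ℝ) + 1) * s * (((k : ℝ) + 1) * s) = ((k : ℝ) + 1) * ((k : ℝ) + 1) * (s * s) := by
      ring
    rw [e, hss, hyy] at hm
    linarith
  -- conclude
  have hcast : ((((k : ℕ) : ℤ) : ℝ)) = (k : ℝ) := by norm_cast
  rw [hcast]
  have hrepr : 1 / s - (k : ℝ) / y = (y - k * s) / (s * y) := by
    field_simp
  rw [hrepr, abs_of_nonneg (div_nonneg (by linarith) (by positivity)),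
    div_le_iff₀ (by positivity)]
  have hone : (1 / 2 : ℝ) ^ n * y = 1 := by rw [hy, ← mul_pow]; norm_num
  calc y - k * s ≤ s := by linarith
    _ = (1 / 2 : ℝ) ^ n * (s * y) := by rw [mul_comm s y, ← mul_assoc, hone, one_mul]

/-- **`1/√2` is a polynomial-time computable real** (name `n ↦ ⌊2ⁿ/√2⌋`, computed by the
digit-by-digit square root). [cite: Ko1991, §2.2 (algebraic reals are polynomial-time computable)] -/
theorem isPolyTimeComputableReal_one_div_sqrt_two : IsPolyTimeComputableReal (1 / Real.sqrt 2) :=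
  ⟨_, polyTimeComputable_sqrtHalfName, abs_one_div_sqrt_two_sub_le⟩

/-- `1/√2 = √2/2`. [folklore] -/
theorem one_div_sqrt_two_eq : (1 : ℝ) / Real.sqrt 2 = Real.sqrt 2 / 2 := by
  rw [div_eq_div_iff (Real.sqrt_ne_zero'.2 two_pos) two_ne_zero, one_mul,
    Real.mul_self_sqrt zero_le_two]

/-- `√2/2` is a polynomial-time computable real. [cite: Ko1991, §2.2] -/
theorem isPolyTimeComputableReal_sqrt_two_div_two : IsPolyTimeComputableReal (Real.sqrt 2 / 2) :=
  one_div_sqrt_two_eq ▸ isPolyTimeComputableReal_one_div_sqrt_two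

/-- `0` is a polynomial-time computable real. [cite: Ko1991, §2.1] -/
theorem isPolyTimeComputableReal_zero : IsPolyTimeComputableReal 0 := by
  simpa using IsPolyTimeComputableReal.ratCast_holds 0

/-- `1` is a polynomial-time computable real. [cite: Ko1991, §2.1] -/
theorem isPolyTimeComputableReal_one : IsPolyTimeComputableReal 1 := by
  simpa using IsPolyTimeComputableReal.ratCast_holds 1

/-! ### The Clifford+T amplitudes -/

/-- `0 ∈ C̃`. [cite: BernsteinVazirani1997, Def. 3.2] -/
theorem isPolyTimeComputableComplex_zero : IsPolyTimeComputableComplex 0 := by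
  simpa using isPolyTimeComputableComplex_ratCast 0

/-- `1 ∈ C̃`. [cite: BernsteinVazirani1997, Def. 3.2] -/
theorem isPolyTimeComputableComplex_one : IsPolyTimeComputableComplex 1 := by
  simpa using isPolyTimeComputableComplex_ratCast 1

/-- `i ∈ C̃`. [cite: BernsteinVazirani1997, Def. 3.2] -/
theorem isPolyTimeComputableComplex_I : IsPolyTimeComputableComplex Complex.I :=
  ⟨by rw [Complex.I_re]; exact isPolyTimeComputableReal_zero,
    by rw [Complex.I_im]; exact isPolyTimeComputableReal_one⟩

/-- `1/√2 ∈ C̃` (the Hadamard amplitude). [cite: BernsteinVazirani1997, Def. 3.2 and §6] -/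
theorem isPolyTimeComputableComplex_one_div_sqrt_two :
    IsPolyTimeComputableComplex (1 / (Real.sqrt 2 : ℂ)) := by
  refine ⟨?_, ?_⟩
  · rw [Complex.div_ofReal_re, Complex.one_re]
    exact isPolyTimeComputableReal_one_div_sqrt_two
  · rw [Complex.div_ofReal_im, Complex.one_im, zero_div]
    exact isPolyTimeComputableReal_zero

/-- `e^{iπ/4} = cos(π/4) + i sin(π/4) = (1 + i)/√2 ∈ C̃` (the `T`-gate phase).
[cite: BernsteinVazirani1997, Def. 3.2 and §6] -/
theorem isPolyTimeComputableComplex_exp_pi_div_four :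
    IsPolyTimeComputableComplex (Complex.exp (Real.pi / 4 * Complex.I)) := by
  have h : (Real.pi / 4 * Complex.I : ℂ) = ((Real.pi / 4 : ℝ) : ℂ) * Complex.I := by
    push_cast; ring
  rw [h]
  refine ⟨?_, ?_⟩
  · rw [Complex.exp_ofReal_mul_I_re, Real.cos_pi_div_four]
    exact isPolyTimeComputableReal_sqrt_two_div_two
  · rw [Complex.exp_ofReal_mul_I_im, Real.sin_pi_div_four]
    exact isPolyTimeComputableReal_sqrt_two_div_two

/-- **The entries of the Clifford+T gates `H, S, T, CNOT` are polynomial-time computable complex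
numbers** (`0, 1, ±1/√2, i, e^{iπ/4}`): the hypothesis "`∀ g i j, G.mat g i j ∈
polyTimeComputableComplex`" of `BQPOver_eq_BQP` / `PromiseBQPOver_eq_PromiseBQP` holds for the
reference gate set `cliffordT` itself. [cite: BernsteinVazirani1997, Def. 3.2 and §6]
[cite: NielsenChuang2010, §4.2 Fig. 4.2] -/
theorem cliffordT_polyTimeEntries :
    ∀ (g : cliffordT.Op) (i j : QReg (cliffordT.arity g)),
      cliffordT.mat g i j ∈ polyTimeComputableComplex := by
  rintro (_ | _ | _ | _) i j <;> rw [mem_polyTimeComputableComplex_iff]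
  · change IsPolyTimeComputableComplex (hGate i j)
    simp only [hGate, Matrix.of_apply]
    split_ifs
    · exact isPolyTimeComputableComplex_one_div_sqrt_two.neg
    · exact isPolyTimeComputableComplex_one_div_sqrt_two
  · change IsPolyTimeComputableComplex (sGate i j)
    simp only [sGate, Matrix.of_apply]
    split_ifs
    · exact isPolyTimeComputableComplex_I
    · exact isPolyTimeComputableComplex_one
    · exact isPolyTimeComputableComplex_zero
  · change IsPolyTimeComputableComplex (tGate i j)
    simp only [tGate, Matrix.of_apply]
    split_ifs
    · exact isPolyTimeComputableComplex_exp_pi_div_four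
    · exact isPolyTimeComputableComplex_one
    · exact isPolyTimeComputableComplex_zero
  · change IsPolyTimeComputableComplex (cnot i j)
    simp only [cnot, Matrix.of_apply]
    split_ifs
    · exact isPolyTimeComputableComplex_one
    · exact isPolyTimeComputableComplex_zero

/-- The entries of the Toffoli+Hadamard gates `H, X, CNOT, TOF` are polynomial-time computable
complex numbers (`0, 1, ±1/√2`). [cite: BernsteinVazirani1997, Def. 3.2 and §6] -/
theorem toffoliH_polyTimeEntries :
    ∀ (g : toffoliH.Op) (i j : QReg (toffoliH.arity g)),
      toffoliH.mat g i j ∈ polyTimeComputableComplex := by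
  rintro (_ | _ | _ | _) i j <;> rw [mem_polyTimeComputableComplex_iff]
  · change IsPolyTimeComputableComplex (hGate i j)
    simp only [hGate, Matrix.of_apply]
    split_ifs
    · exact isPolyTimeComputableComplex_one_div_sqrt_two.neg
    · exact isPolyTimeComputableComplex_one_div_sqrt_two
  · change IsPolyTimeComputableComplex (pauliX i j)
    simp only [pauliX, Matrix.of_apply]
    split_ifs
    · exact isPolyTimeComputableComplex_zero
    · exact isPolyTimeComputableComplex_one
  · change IsPolyTimeComputableComplex (cnot i j)
    simp only [cnot, Matrix.of_apply]
    split_ifs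
    · exact isPolyTimeComputableComplex_one
    · exact isPolyTimeComputableComplex_zero
  · change IsPolyTimeComputableComplex (toffoli i j)
    simp only [toffoli, Matrix.of_apply]
    split_ifs
    · exact isPolyTimeComputableComplex_one
    · exact isPolyTimeComputableComplex_zero

end Literature.Computability.Cryptography
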